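import Summits.AtomisticToContinuum.BoseEinsteinCondensation.Theses.BECRichardsonGaudin
import Literature.Barriers.AtomisticToContinuum.KineticGapLengthScalesAssembly
import Literature.MathematicalPhysics.QuantumManyBody.TorusBoseFockLayer
import Summits.AtomisticToContinuum.BoseEinsteinCondensation.Theorems.DensityResponse.Negative.ModeZeroEtaOrbital

/-!
# Route `BECRichardsonGaudin`, crux `BeliaevDeformationBound` (stmt-AtomisticToContinuum-14804):
# the comparison follows from complete condensation (the "sandwich" reduction)

Lead-prover bookkeeping for the line `registered` (`Cruxes/BeliaevDeformationBound/Lines/birth.lean`),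
supporting (not closing) stmt-AtomisticToContinuum-14804.

The crux has the comparison shape `Cmp(X, E; ε)`: every `δ`-near-minimiser `Ψ` of a functional `X`
(the periodic energy) on `PeriodicTrialState N L` admits a `δ'`-near-minimiser `Φ` of a second
functional `E` (Richardson's anchor) with `n₀(Φ) ≤ n₀(Ψ) + εN`. Two facts of soft analysis settle this
shape whenever the near-minimisers of `X` are `ε`-completely condensed (`n₀(Ψ) ≥ (1-ε)N`):
`δ'`-near-minimisers of ANY functional `E` exist (`exists_le_iInf_add`), and `n₀ ≤ N` for every
periodic state (tree: `condensateOccupation_le_card`). Hence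

* `stub_comparisonOfCondensation` (registered stub B3 of the line's skeleton v2) — `Cmp(X, E; ε)` for arbitrary `X, E : PeriodicTrialState N L → ℝ≥0∞`
  from `ε`-complete condensation of the `δ`-near-minimisers of `X`;
* `beliaevDeformationBound_of_completeCondensation` — complete Bose–Einstein condensation of the soft
  (`∫ v < ∞`) periodic dilute gas in the thermodynamic limit (for every `ε > 0`, at all small `ρ`,
  eventually in `N`, the `δ`-near-minimisers of `periodicEnergy v` on the torus of side `(N/ρ)^{1/3}`
  have `n₀ ≥ (1-ε)N`) implies the crux `BeliaevDeformationBound` outright — with no input about the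
  anchor. (The hypothesis is the open problem of the summit conjunct in its strong, complete form; this
  file records that the crux is AT MOST that hard. The refuter note rreview-0815 on the item records the
  converse sandwich `crux ⇒ (3/4 - ε)`-condensation of the soft gas.)

* `threeQuarterCondensation_of_beliaevDeformationBound` (appended) — the LOWER sandwich: the crux
  ALONE gives `(3/4 - ε)`-condensation of the soft periodic gas (`∫v ≠ 0`): the anchor functional
  satisfies `E ≥ 2ργ(N - n₀)` termwise and equals `γρ(N-1)/2` at the constant state `Φ_c ≡ L^{-3N/2}`
  (the tree's `DensityResponse.Negative.constState`: `K = 0`, `n₀ = N`, and only the zero mode of the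
  band survives `∫_Ω∫_Ω conj(w)`, which is `L⁶`), so the anchor near-minimiser returned by the crux has
  `N - n₀Φ ≤ (N-1)/4 + δ'/(2ργ)`; no condensation property of the anchor (`RichardsonAnchorBEC`) is
  used — for the conjunct's `∃ c > 0` form the anchor theorem is idle. So: complete BEC (soft) ⇒ crux ⇒
  `3/4`-BEC (soft).
* `completeCondensation_of_anchor_of_comparison` (appended) — ranks 2 + 3 of the route together give
  COMPLETE condensation of the soft gas (the route's bet in its strong form; `closes` is its `ε = 1/4`).

References: LSSY2005 §1.2 (1.17)–(1.19), Ch. 5 (5.17) (`n₀ ≤ N`); the line card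
`Cruxes/BeliaevDeformationBound/Lines/birth.md`.
-/

noncomputable section

namespace Summit.AtomisticToContinuum.BoseEinsteinCondensation.Theorems.BeliaevDeformationBound

open MeasureTheory Filter Literature.MathematicalPhysics.QuantumManyBody.BoseGas
open scoped ENNReal

/-- Near-minimisers exist: for every `ℝ≥0∞`-valued functional `E` on an inhabited type and every
`δ' > 0` there is `Φ` with `E Φ ≤ inf E + δ'` (if `inf E = ⊤` every `Φ` qualifies). [folklore] -/
theorem exists_le_iInf_add {α : Type*} (E : α → ℝ≥0∞) (a : α) {δ' : ℝ≥0∞} (hδ' : 0 < δ') :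
    ∃ Φ : α, E Φ ≤ (⨅ Φ', E Φ') + δ' := by
  by_cases h : (⨅ Φ', E Φ') = ⊤
  · exact ⟨a, by rw [h, top_add]; exact le_top⟩
  · have hlt : (⨅ Φ', E Φ') < (⨅ Φ', E Φ') + δ' := ENNReal.lt_add_right h hδ'.ne'
    obtain ⟨Φ, hΦ⟩ := iInf_lt_iff.mp hlt
    exact ⟨Φ, hΦ.le⟩

/-- `N ≤ n₀(Ψ) + εN` as soon as `(1-ε)N ≤ n₀(Ψ)`, in `ℝ≥0∞`. [folklore] -/
theorem natCast_le_add_of_ofReal_le {N : ℕ} {ε : ℝ} {x : ℝ≥0∞}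
    (h : ENNReal.ofReal ((1 - ε) * N) ≤ x) : (N : ℝ≥0∞) ≤ x + ENNReal.ofReal (ε * N) := by
  calc (N : ℝ≥0∞) = ENNReal.ofReal ((1 - ε) * N + ε * N) := by
        rw [← ENNReal.ofReal_natCast]; congr 1; ring
    _ ≤ ENNReal.ofReal ((1 - ε) * N) + ENNReal.ofReal (ε * N) := ENNReal.ofReal_add_le
    _ ≤ x + ENNReal.ofReal (ε * N) := add_le_add h le_rfl

/-- **The comparison shape follows from complete condensation** ("sandwich"): if the `δ₀`-near-
minimisers of `X` all have `n₀ ≥ (1-ε)N`, then for every `δ' > 0` (take `δ := δ₀`) every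
`δ`-near-minimiser `Ψ` of `X` admits a `δ'`-near-minimiser `Φ` of `E` — any one — with
`n₀(Φ) ≤ N ≤ n₀(Ψ) + εN`. Valid for arbitrary functionals `X, E` on the periodic trial states of the
torus of side `L > 0`. [cite: LSSY2005, Ch. 5 (5.17)] -/
theorem stub_comparisonOfCondensation :
  ∀ (N : ℕ) (L ε : ℝ), 0 < L → ∀ (X E : PeriodicTrialState N L → ENNReal),
    (∃ δ : ENNReal, 0 < δ ∧ ∀ Ψ : PeriodicTrialState N L, X Ψ ≤ (⨅ Ψ', X Ψ') + δ →
      ENNReal.ofReal ((1 - ε) * (N : ℝ)) ≤ condensateOccupation N L Ψ.ψ) →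
    ∀ δ' : ENNReal, 0 < δ' → ∃ δ : ENNReal, 0 < δ ∧ ∀ Ψ : PeriodicTrialState N L,
      X Ψ ≤ (⨅ Ψ', X Ψ') + δ → ∃ Φ : PeriodicTrialState N L, E Φ ≤ (⨅ Φ', E Φ') + δ' ∧
        condensateOccupation N L Φ.ψ ≤ condensateOccupation N L Ψ.ψ + ENNReal.ofReal (ε * (N : ℝ)) := by
  intro N L ε hL X E hX δ' hδ'
  obtain ⟨δ, hδ, hX⟩ := hX
  refine ⟨δ, hδ, fun Ψ hΨ => ?_⟩
  obtain ⟨Φ, hΦ⟩ := exists_le_iInf_add E Ψ hδ'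
  refine ⟨Φ, hΦ, ?_⟩
  calc condensateOccupation N L Φ.ψ ≤ (N : ℝ≥0∞) :=
        Literature.Barriers.AtomisticToContinuum.BoseGas.condensateOccupation_le_card hL Φ
    _ ≤ condensateOccupation N L Ψ.ψ + ENNReal.ofReal (ε * N) :=
        natCast_le_add_of_ofReal_le (hX Ψ hΨ)

/-- **Complete condensation of the soft periodic gas implies the crux `BeliaevDeformationBound`.**
If for every repulsive finite-range `v` with `∫ v(|x|) dx < ∞` and every `ε > 0` there is `ρ₀ > 0`
such that for `0 < ρ < ρ₀`, eventually in `N`, some `δ > 0` makes every periodic trial state `Ψ` on the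
torus of side `(N/ρ)^{1/3}` with `⟨Ψ, HΨ⟩ ≤ E₀^per + δ` satisfy `n₀(Ψ) ≥ (1-ε)N` (complete BEC in the
dilute limit, thermodynamic limit first), then every such near-minimiser is at least as condensed, up
to `εN`, as ANY `δ'`-near-minimiser of Richardson's matched anchor functional — in particular the crux
holds. The anchor enters only through the existence of its near-minimisers. [cite: LSSY2005, Ch. 5 (5.17)] -/
theorem beliaevDeformationBound_of_completeCondensation
    (h : ∀ v : ℝ → ℝ≥0∞, IsRepulsiveFiniteRange v → (∫⁻ x : Space, v ‖x‖) ≠ ⊤ →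
      ∀ ε : ℝ, 0 < ε → ∃ ρ₀ : ℝ, 0 < ρ₀ ∧ ∀ ρ : ℝ, 0 < ρ → ρ < ρ₀ → ∀ᶠ N : ℕ in atTop,
        ∃ δ : ℝ≥0∞, 0 < δ ∧ ∀ Ψ : PeriodicTrialState N (sideLength ρ N),
          periodicEnergy v Ψ ≤ periodicGroundStateEnergy v N (sideLength ρ N) + δ →
            ENNReal.ofReal ((1 - ε) * N) ≤ condensateOccupation N (sideLength ρ N) Ψ.ψ) :
    Summit.AtomisticToContinuum.BoseEinsteinCondensation.Theses.BECRichardsonGaudin.BeliaevDeformationBound := by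
  intro v Λ ε hv hint _hΛ hε
  obtain ⟨ρ₀, hρ₀, H⟩ := h v hv hint ε hε
  refine ⟨ρ₀, hρ₀, fun ρ hρ hρlt => ?_⟩
  have H2 : ∀ᶠ n : ℕ in atTop, ∃ δ : ℝ≥0∞, 0 < δ ∧
      ∀ Ψ : PeriodicTrialState (n + 2) (sideLength ρ (n + 2)),
        periodicEnergy v Ψ ≤ periodicGroundStateEnergy v (n + 2) (sideLength ρ (n + 2)) + δ →
          ENNReal.ofReal ((1 - ε) * ((n + 2 : ℕ) : ℝ)) ≤
            condensateOccupation (n + 2) (sideLength ρ (n + 2)) Ψ.ψ :=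
    (tendsto_add_atTop_nat 2).eventually (H ρ hρ hρlt)
  filter_upwards [H2] with n hn
  dsimp only
  have hL : 0 < sideLength ρ (n + 2) := by
    unfold sideLength
    exact Real.rpow_pos_of_pos (div_pos (by exact_mod_cast Nat.succ_pos _) hρ) _
  exact stub_comparisonOfCondensation (n + 2) _ ε hL (fun Ψ => periodicEnergy v Ψ) _ hn

/-! ## The lower sandwich: the crux alone gives `(3/4 - ε)`-condensation (appended 2026-08-17) -/

section LowerSandwich

open scoped ComplexConjugate
open Summit.AtomisticToContinuum.BoseEinsteinCondensation.Theorems.DensityResponse.Negative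
  (constState periodicEnergy_zero_constState)

variable {L : ℝ}

/-! ### The constant state `Φ_c ≡ L^{-3N/2}` and its three expectations -/

/-- The constant state `Φ_c ≡ (L³)^{-N/2}` of the torus is the tree's
`DensityResponse.Negative.constState` (landed); unfolding lemma. [cite: Fournais2020, (1.3)] -/
theorem constState_ψ_eq (N : ℕ) (hL : 0 < L) (X : Config N) :
    (constState N hL).ψ X = ((Real.sqrt ((L ^ 3) ^ N))⁻¹ : ℂ) := rfl

/-- `‖(L³)^{-N/2}‖² = (L³)^{-N}` in `ℝ≥0∞`. [folklore] -/
theorem nnnorm_constState_amp_sq (N : ℕ) (hL : 0 < L) :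
    ((‖((Real.sqrt ((L ^ 3) ^ N))⁻¹ : ℂ)‖₊ : ℝ≥0∞) ^ 2) = ((ENNReal.ofReal L ^ 3) ^ N)⁻¹ := by
  have hV : 0 < (L ^ 3) ^ N := by positivity
  rw [coe_nnnorm_sq_eq_ofReal, norm_inv, Complex.norm_real, Real.norm_of_nonneg (Real.sqrt_nonneg _),
    inv_pow, Real.sq_sqrt hV.le, ENNReal.ofReal_inv_of_pos hV, ENNReal.ofReal_pow (by positivity),
    ENNReal.ofReal_pow hL.le]

/-- `∫_Ω c dx = L³ c` on the cell. [folklore] -/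
theorem setIntegral_cell_const (hL : 0 < L) (c : ℂ) :
    ∫ _x in cell L, c = ((L ^ 3 : ℝ) : ℂ) * c := by
  rw [setIntegral_const, Measure.real, volume_cell, ← ENNReal.ofReal_pow hL.le,
    ENNReal.toReal_ofReal (by positivity), Complex.real_smul]

/-- `‖L³‖₊² = (ofReal L ^ 3)²` in `ℝ≥0∞`. [folklore] -/
theorem nnnorm_cube_sq (hL : 0 < L) :
    ((‖((L ^ 3 : ℝ) : ℂ)‖₊ : ℝ≥0∞) ^ 2) = (ENNReal.ofReal L ^ 3) ^ 2 := by
  rw [coe_nnnorm_sq_eq_ofReal, Complex.norm_real, Real.norm_of_nonneg (by positivity),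
    ENNReal.ofReal_pow (by positivity), ENNReal.ofReal_pow hL.le]

/-- The constant state is fully condensed: `n₀(Φ_c) = N`. [cite: Fournais2020, (1.3)–(1.5)] -/
theorem condensateOccupation_constState (n : ℕ) (hL : 0 < L) :
    condensateOccupation (n + 1) L (constState (n + 1) hL).ψ = ((n + 1 : ℕ) : ℝ≥0∞) := by
  have h0 : ENNReal.ofReal L ^ 3 ≠ 0 := pow_ne_zero _ (by simpa using hL)
  have htop : ENNReal.ofReal L ^ 3 ≠ ⊤ := ENNReal.pow_ne_top ENNReal.ofReal_ne_top
  rw [condensateOccupation_succ hL]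
  simp only [constState_ψ_eq, setIntegral_cell_const hL, nnnorm_mul, ENNReal.coe_mul, mul_pow,
    nnnorm_cube_sq hL, nnnorm_constState_amp_sq _ hL]
  rw [setLIntegral_const, volume_cellN]
  push_cast
  set V := ENNReal.ofReal L ^ 3 with hV
  have hVn : V ^ (n + 1) ≠ 0 := pow_ne_zero _ h0
  have hVn' : V ^ (n + 1) ≠ ⊤ := ENNReal.pow_ne_top htop
  have : V⁻¹ * (V ^ 2 * (V ^ (n + 1))⁻¹ * V ^ n) = 1 := by
    calc V⁻¹ * (V ^ 2 * (V ^ (n + 1))⁻¹ * V ^ n)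
        = (V⁻¹ * V) * (V ^ (n + 1) * (V ^ (n + 1))⁻¹) := by ring
      _ = 1 := by rw [ENNReal.inv_mul_cancel h0 htop, ENNReal.mul_inv_cancel hVn hVn', one_mul]
  rw [this, mul_one]

/-- **Only the zero mode of the band survives the double cell average**: for every `M` and every
constant `c`, `∫_Ω∫_Ω conj(w_M(x,y)) c dx dy = L⁶ c`, where
`w_M(x,y) = Σ_{m ∈ {-M..M}³} e^{2πi m·(x-y)/L}` is the band kernel of the route (written in the
literal form of the Theses file). [cite: LSSY2005, App. A (A.3)–(A.5)] -/
theorem integral_cell_cell_conj_bandKernel_const (hL : 0 < L) (M : ℕ) (c : ℂ) :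
    ∫ x in cell L, ∫ y in cell L,
      conj (∑ m ∈ Fintype.piFinset (fun _ : Fin 3 => Finset.Icc (-(M : ℤ)) M),
        Complex.exp (2 * Real.pi * Complex.I / L * ∑ j : Fin 3, (m j : ℂ) * ((x j - y j : ℝ) : ℂ))) * c =
      ((L ^ 3 : ℝ) : ℂ) * ((L ^ 3 : ℝ) : ℂ) * c := by
  have hk : ∀ x y : Space,
      conj (∑ m ∈ Fintype.piFinset (fun _ : Fin 3 => Finset.Icc (-(M : ℤ)) M),
        Complex.exp (2 * Real.pi * Complex.I / L * ∑ j : Fin 3, (m j : ℂ) * ((x j - y j : ℝ) : ℂ))) =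
        ∑ m ∈ momentumBand M, cellWave L (-m) x * cellWave L m y := by
    intro x y
    rw [← bandKernel_eq, bandKernel, map_sum]
    refine Finset.sum_congr rfl fun m _ => ?_
    rw [← cellWave_mul_cellWave_neg, map_mul, conj_cellWave, conj_cellWave, neg_neg]
  have hinner : ∀ x : Space,
      ∫ y in cell L, conj (∑ m ∈ Fintype.piFinset (fun _ : Fin 3 => Finset.Icc (-(M : ℤ)) M),
        Complex.exp (2 * Real.pi * Complex.I / L * ∑ j : Fin 3, (m j : ℂ) * ((x j - y j : ℝ) : ℂ))) * c =
        ((L ^ 3 : ℝ) : ℂ) * c := by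
    intro x
    simp_rw [hk]
    rw [integral_mul_const]
    congr 1
    have hint : ∀ m ∈ momentumBand M,
        Integrable (fun y => cellWave L (-m) x * cellWave L m y) (volume.restrict (cell L)) :=
      fun m _ => integrableOn_cell
        (continuous_const.mul (continuous_cellWave L m) :
          Continuous fun y => cellWave L (-m) x * cellWave L m y)
    rw [integral_finsetSum _ hint]
    have hterm : ∀ m ∈ momentumBand M, ∫ y in cell L, cellWave L (-m) x * cellWave L m y =
        if m = 0 then ((L ^ 3 : ℝ) : ℂ) else 0 := by
      intro m _
      rw [integral_const_mul]
      split_ifs with hm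
      · subst hm
        rw [neg_zero, cellWave_zero, one_mul, integral_cell_cellWave_zero hL]
        push_cast
        ring
      · rw [integral_cell_cellWave_eq_zero hL hm, mul_zero]
    rw [Finset.sum_congr rfl hterm, Finset.sum_ite_eq' (momentumBand M) (0 : Momentum),
      if_pos (zero_mem_momentumBand M)]
  simp_rw [hinner]
  rw [setIntegral_cell_const hL, mul_assoc]

/-- `n₀(Φ_c) = N` for `N = n + 2` (the indexing of the crux). [cite: Fournais2020, (1.3)–(1.5)] -/
theorem condensateOccupation_constState_two (n : ℕ) (hL : 0 < L) :
    condensateOccupation (n + 2) L (constState (n + 2) hL).ψ = ((n + 2 : ℕ) : ℝ≥0∞) :=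
  condensateOccupation_constState (n + 1) hL

/-- `‖L³ · L³ · (L³)^{-N/2}‖₊²` times the volume `(L³)ⁿ` of `Ω^{N-2}` is `(L³)²` (`N = n + 2`), in
`ℝ≥0∞`. [folklore] -/
theorem nnnorm_pairIntegral_const_sq_mul (n : ℕ) (hL : 0 < L) :
    ((‖((L ^ 3 : ℝ) : ℂ) * ((L ^ 3 : ℝ) : ℂ) * ((Real.sqrt ((L ^ 3) ^ (n + 2)))⁻¹ : ℂ)‖₊ : ℝ≥0∞) ^ 2) *
        (ENNReal.ofReal L ^ 3) ^ n = ENNReal.ofReal ((L ^ 3) ^ 2) := by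
  have h0 : ENNReal.ofReal L ^ 3 ≠ 0 := pow_ne_zero _ (by simpa using hL)
  have htop : ENNReal.ofReal L ^ 3 ≠ ⊤ := ENNReal.pow_ne_top ENNReal.ofReal_ne_top
  rw [nnnorm_mul, nnnorm_mul, ENNReal.coe_mul, ENNReal.coe_mul, mul_pow, mul_pow, nnnorm_cube_sq hL,
    nnnorm_constState_amp_sq _ hL]
  set V := ENNReal.ofReal L ^ 3 with hV
  have hVn : V ^ (n + 2) ≠ 0 := pow_ne_zero _ h0
  have hVn' : V ^ (n + 2) ≠ ⊤ := ENNReal.pow_ne_top htop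
  calc V ^ 2 * V ^ 2 * (V ^ (n + 2))⁻¹ * V ^ n = V ^ 2 * (V ^ (n + 2) * (V ^ (n + 2))⁻¹) := by ring
    _ = V ^ 2 := by rw [ENNReal.mul_inv_cancel hVn hVn', mul_one]
    _ = ENNReal.ofReal ((L ^ 3) ^ 2) := by
        rw [hV, ← ENNReal.ofReal_pow hL.le, ← ENNReal.ofReal_pow (by positivity)]

/-! ### The lower sandwich -/

/-- **The crux `BeliaevDeformationBound` alone gives `(3/4 - ε)`-condensation of the soft periodic
gas.** For every repulsive finite-range `v` with `0 < ∫ v(|x|) dx < ∞` and every `ε > 0` there is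
`ρ₀ > 0` such that for `0 < ρ < ρ₀`, eventually in `N = n + 2`, some `δ > 0` makes every `δ`-near-
minimiser `Ψ` of the periodic energy on the torus of side `(N/ρ)^{1/3}` satisfy
`n₀(Ψ) ≥ (3/4 - ε)N`. Proof: apply the crux with `Λ = 1`, `ε/2` and the anchor slack
`δ' = ργε`; the anchor near-minimiser `Φ` it returns has
`2ργ(N - n₀Φ) ≤ E(Φ) ≤ E(Φ_c) + δ' = γρ(N-1)/2 + ργε` (constant state), so
`n₀Ψ ≥ n₀Φ - (ε/2)N ≥ N - (N-1)/4 - ε/2 - (ε/2)N ≥ (3/4 - ε)N`. No property of the anchor beyond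
`E ≥ 2ργ(N - n₀)` and the value at the constant state is used. [cite: LSSY2005, Ch. 5 (5.17)] -/
theorem threeQuarterCondensation_of_beliaevDeformationBound :
    Summit.AtomisticToContinuum.BoseEinsteinCondensation.Theses.BECRichardsonGaudin.BeliaevDeformationBound → ∀ (v : ℝ → ENNReal), IsRepulsiveFiniteRange v → (∫⁻ x : Space, v ‖x‖) ≠ ⊤ → (∫⁻ x : Space, v ‖x‖) ≠ 0 → ∀ ε : ℝ, 0 < ε → ∃ ρ₀ : ℝ, 0 < ρ₀ ∧ ∀ ρ : ℝ, 0 < ρ → ρ < ρ₀ → ∀ᶠ n : ℕ in Filter.atTop, ∃ δ : ENNReal, 0 < δ ∧ ∀ Ψ : PeriodicTrialState (n + 2) (sideLength ρ (n + 2)), periodicEnergy v Ψ ≤ periodicGroundStateEnergy v (n + 2) (sideLength ρ (n + 2)) + δ → ENNReal.ofReal ((3 / 4 - ε) * ((n + 2 : ℕ) : ℝ)) ≤ condensateOccupation (n + 2) (sideLength ρ (n + 2)) Ψ.ψ := by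
  intro h v hv hint h0 ε hε
  obtain ⟨ρ₀, hρ₀, H⟩ := h v 1 (ε / 2) hv hint one_pos (half_pos hε)
  refine ⟨ρ₀, hρ₀, fun ρ hρ hρlt => ?_⟩
  filter_upwards [H ρ hρ hρlt] with n hn
  dsimp only at hn
  have hL : 0 < sideLength ρ (n + 2) := by
    unfold sideLength
    exact Real.rpow_pos_of_pos (div_pos (by exact_mod_cast Nat.succ_pos _) hρ) _
  have hρL : ((n + 2 : ℕ) : ℝ) / sideLength ρ (n + 2) ^ 3 = ρ :=
    div_sideLength_pow_three hρ (Nat.succ_pos _)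
  set L := sideLength ρ (n + 2) with hLdef
  have hγ : 0 < (∫⁻ x : Space, v ‖x‖).toReal := ENNReal.toReal_pos h0 hint
  set γ := (∫⁻ x : Space, v ‖x‖).toReal with hγdef
  have hN1 : (1 : ℝ) ≤ ((n + 2 : ℕ) : ℝ) - 1 := by push_cast; linarith
  -- the slack granted to the anchor
  have hδ' : (0 : ℝ≥0∞) < ENNReal.ofReal (ρ * γ * ε) := ENNReal.ofReal_pos.mpr (by positivity)
  obtain ⟨δ, hδ, Hδ⟩ := hn _ hδ'
  refine ⟨δ, hδ, fun Ψ hΨ => ?_⟩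
  obtain ⟨Φ, hΦE, hΦn⟩ := Hδ Ψ hΨ
  -- Step 1: `2ργ(N - n₀Φ) ≤ E(Φ) ≤ inf E + δ' ≤ E(Φ_c) + δ' = γρ(N-1)/2 + ργε`
  have hmain : ENNReal.ofReal (2 * ρ * γ) *
        (((n + 2 : ℕ) : ℝ≥0∞) - condensateOccupation (n + 2) L Φ.ψ) ≤
      ENNReal.ofReal (γ * ρ * (((n + 2 : ℕ) : ℝ) - 1) / 2) + ENNReal.ofReal (ρ * γ * ε) := by
    refine (le_add_right (le_add_left le_rfl)).trans (hΦE.trans ?_)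
    refine add_le_add (iInf_le_of_le (constState (n + 2) hL) (le_of_eq ?_)) le_rfl
    simp only [periodicEnergy_zero_constState, condensateOccupation_constState_two, tsub_self,
      mul_zero, zero_add, constState_ψ_eq, integral_cell_cell_conj_bandKernel_const hL]
    rw [setLIntegral_const, volume_cellN, nnnorm_pairIntegral_const_sq_mul n hL,
      ← ENNReal.ofReal_mul (by positivity)]
    congr 1
    rw [← hρL]
    field_simp
  -- Step 2: bookkeeping in `ℝ`
  have hNtop : ((n + 2 : ℕ) : ℝ≥0∞) ≠ ⊤ := ENNReal.natCast_ne_top _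
  have hΦle : condensateOccupation (n + 2) L Φ.ψ ≤ ((n + 2 : ℕ) : ℝ≥0∞) :=
    Literature.Barriers.AtomisticToContinuum.BoseGas.condensateOccupation_le_card hL Φ
  have hΨle : condensateOccupation (n + 2) L Ψ.ψ ≤ ((n + 2 : ℕ) : ℝ≥0∞) :=
    Literature.Barriers.AtomisticToContinuum.BoseGas.condensateOccupation_le_card hL Ψ
  have hΨtop : condensateOccupation (n + 2) L Ψ.ψ ≠ ⊤ := ne_top_of_le_ne_top hNtop hΨle
  set d := ((n + 2 : ℕ) : ℝ≥0∞) - condensateOccupation (n + 2) L Φ.ψ with hd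
  have hdtop : d ≠ ⊤ := ne_top_of_le_ne_top hNtop tsub_le_self
  have hreal : 2 * ρ * γ * d.toReal ≤ γ * ρ * (((n + 2 : ℕ) : ℝ) - 1) / 2 + ρ * γ * ε := by
    have := ENNReal.toReal_mono
      (ENNReal.add_ne_top.mpr ⟨ENNReal.ofReal_ne_top, ENNReal.ofReal_ne_top⟩) hmain
    rwa [ENNReal.toReal_mul, ENNReal.toReal_ofReal (by positivity),
      ENNReal.toReal_add ENNReal.ofReal_ne_top ENNReal.ofReal_ne_top,
      ENNReal.toReal_ofReal (by positivity), ENNReal.toReal_ofReal (by positivity)] at this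
  have h2 : 0 < 2 * ρ * γ := by positivity
  have hd_r : d.toReal ≤ (((n + 2 : ℕ) : ℝ) - 1) / 4 + ε / 2 := by
    by_contra hcon
    push Not at hcon
    have := mul_lt_mul_of_pos_left hcon h2
    linarith
  have hΦn_r : (condensateOccupation (n + 2) L Φ.ψ).toReal ≤
      (condensateOccupation (n + 2) L Ψ.ψ).toReal + ε / 2 * ((n + 2 : ℕ) : ℝ) := by
    have := ENNReal.toReal_mono (ENNReal.add_ne_top.mpr ⟨hΨtop, ENNReal.ofReal_ne_top⟩) hΦn
    rwa [ENNReal.toReal_add hΨtop ENNReal.ofReal_ne_top,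
      ENNReal.toReal_ofReal (by positivity)] at this
  have hΦ_r : (condensateOccupation (n + 2) L Φ.ψ).toReal = ((n + 2 : ℕ) : ℝ) - d.toReal := by
    rw [hd, ENNReal.toReal_sub_of_le hΦle hNtop, ENNReal.toReal_natCast]
    ring
  have hεN : ε * 1 ≤ ε * (((n + 2 : ℕ) : ℝ) - 1) := mul_le_mul_of_nonneg_left hN1 hε.le
  have hfinal : (3 / 4 - ε) * ((n + 2 : ℕ) : ℝ) ≤ (condensateOccupation (n + 2) L Ψ.ψ).toReal := by
    nlinarith
  calc ENNReal.ofReal ((3 / 4 - ε) * ((n + 2 : ℕ) : ℝ))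
      ≤ ENNReal.ofReal ((condensateOccupation (n + 2) L Ψ.ψ).toReal) := ENNReal.ofReal_le_ofReal hfinal
    _ = condensateOccupation (n + 2) L Ψ.ψ := ENNReal.ofReal_toReal hΨtop

end LowerSandwich

/-! ## The route's bet: ranks 2 + 3 give complete condensation (appended 2026-08-17) -/

section RouteBet

open Summit.AtomisticToContinuum.BoseEinsteinCondensation.Theses.BECRichardsonGaudin

/-- **Ranks 2 and 3 of the route give complete condensation of the soft gas**: the anchor's complete
BEC (`RichardsonAnchorBEC` at `ε/2`, `γ = ∫v`, `Λ = 1`) and the comparison (`BeliaevDeformationBound`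
at `ε/2`) give `n₀Ψ ≥ n₀Φ - (ε/2)N ≥ (1 - ε)N` for the gas's near-minimisers. [folklore] -/
theorem completeCondensation_of_anchor_of_comparison (hA : RichardsonAnchorBEC)
    (hB : BeliaevDeformationBound) :
    ∀ (v : ℝ → ENNReal), IsRepulsiveFiniteRange v → (∫⁻ x : Space, v ‖x‖) ≠ ⊤ → ∀ ε : ℝ, 0 < ε →
      ∃ ρ₀ : ℝ, 0 < ρ₀ ∧ ∀ ρ : ℝ, 0 < ρ → ρ < ρ₀ → ∀ᶠ n : ℕ in Filter.atTop,
        ∃ δ : ENNReal, 0 < δ ∧ ∀ Ψ : PeriodicTrialState (n + 2) (sideLength ρ (n + 2)),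
          periodicEnergy v Ψ ≤ periodicGroundStateEnergy v (n + 2) (sideLength ρ (n + 2)) + δ →
            ENNReal.ofReal ((1 - ε) * ((n + 2 : ℕ) : ℝ)) ≤
              condensateOccupation (n + 2) (sideLength ρ (n + 2)) Ψ.ψ := by
  intro v hv hint ε hε
  obtain ⟨ρ₁, hρ₁, h₁⟩ := hA (∫⁻ x : Space, v ‖x‖).toReal 1 (ε / 2) ENNReal.toReal_nonneg one_pos
    (half_pos hε)
  obtain ⟨ρ₂, hρ₂, h₂⟩ := hB v 1 (ε / 2) hv hint one_pos (half_pos hε)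
  refine ⟨min ρ₁ ρ₂, lt_min hρ₁ hρ₂, fun ρ hρ hρlt => ?_⟩
  filter_upwards [h₁ ρ hρ (hρlt.trans_le (min_le_left _ _)),
    h₂ ρ hρ (hρlt.trans_le (min_le_right _ _))] with n hn₁ hn₂
  dsimp only at hn₁ hn₂
  obtain ⟨δA, hδA, HA⟩ := hn₁
  obtain ⟨δ, hδ, HB⟩ := hn₂ δA hδA
  refine ⟨δ, hδ, fun Ψ hΨ => ?_⟩
  obtain ⟨Φ, hΦE, hΦn⟩ := HB Ψ hΨ
  have hlow := (HA Φ hΦE).trans hΦn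
  calc ENNReal.ofReal ((1 - ε) * ((n + 2 : ℕ) : ℝ))
      = ENNReal.ofReal ((1 - ε / 2) * ((n + 2 : ℕ) : ℝ) - ε / 2 * ((n + 2 : ℕ) : ℝ)) := by
        congr 1; ring
    _ = ENNReal.ofReal ((1 - ε / 2) * ((n + 2 : ℕ) : ℝ)) - ENNReal.ofReal (ε / 2 * ((n + 2 : ℕ) : ℝ)) :=
        ENNReal.ofReal_sub _ (by positivity)
    _ ≤ _ := tsub_le_iff_right.mpr hlow

end RouteBet

end Summit.AtomisticToContinuum.BoseEinsteinCondensation.Theorems.BeliaevDeformationBound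

end
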